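/-
VALUE = THEOREM (structure of the isometries fixing an isotropic vector of 𝔽_p³), NOT summit
progress (cell b2b-lgcu-borel, gen 24); the crux item stmt-MatrixMultiplication-14079 is untouched.
-/
import Mathlib
import Literature.NumberTheory.EllipticCurves.BinaryQuarticDiscriminantFpCountProofs
import Summits.MatrixMultiplication.MatrixMultiplication.Theorems.SubgroupIdentityDesigns.Negative.ReflectionClassSiegel

/-!
# Isometries fixing an isotropic vector are Siegel transformations (times `R_y`)

VALUE = THEOREM (generic in the odd prime `p`), NOT summit progress; the crux item
stmt-MatrixMultiplication-14079 is untouched and remains open.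

Layer F4c-2 of the all-`p` proof of the unified reflection-class certificate (ORACLE-g24 §G24-1 (L1),
§G24-3): fix `x ≠ 0` isotropic and an anisotropic `y ⊥ x` in `𝔽_p³` (`p ≠ 2`).

* `exists_partner` — a hyperbolic partner `x'` (`x'·x = 1`, `x' ⊥ y`, `Q(x') = 0`);
* `decomp` / `mat_eq` — coordinates in the basis `x, y, x'`; a matrix is determined by its values
  on `x, y, x'`;
* `stab_structure` — **an isometry `g` (`gᵀ g = 1`) with `g x = x` is `E_β` or `E_β R_y`** for
  some `β`, where `E_β = siegelMat x (β • y)`; with the determinant: `stab_proper` (`det g = 1 ⇒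
  g = E_β`) and `stab_improper` (`det g = −1 ⇒ g = E_β R_y`).
Together with `ReflectionClassSiegel` (group law, freeness) this identifies the proper stabiliser
of an isotropic vector with the `p` Siegel transformations summed in `ReflectionClassOrbitU`.
HONEST SCOPE.  Linear algebra only; by itself it excludes nothing.
-/

set_option linter.dupNamespace false

open scoped BigOperators Matrix

namespace Summit.MatrixMultiplication.MatrixMultiplication.Theorems.SubgroupIdentityDesigns.Negative
namespace ReflectionClassStabIso

open Summit.MatrixMultiplication.MatrixMultiplication.Theorems.LieRankDesigns.Negative (GLm Mat)
open ReflectionClassCertificate (V)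
open NonsquareReflections (reflMat refl coe_refl reflMat_mul_self det_reflMat reflMat_mulVec)
open ReflectionClassOrbitU (siegel)
open ReflectionClassPlane (w₁ triple_sq refl_apply)
open ReflectionClassSphere (exists_smul_of_cross_eq_zero)
open ReflectionClassSiegel (siegelMat siegelMat_mulVec siegelGL coe_siegelGL det_siegelGL)
open Literature.NumberTheory.EllipticCurves.BinaryQuartic (two_ne_zero_zmod)

variable {p : ℕ} [hp : Fact p.Prime]

section Partner

variable {x y : V p}

/-- **Hyperbolic partner.**  For `x ≠ 0` isotropic and `y ⊥ x` anisotropic there is `x'` with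
`x'·x = 1`, `x'·y = 0`, `Q(x') = 0` (`p ≠ 2`). -/
theorem exists_partner (hp2 : p ≠ 2) (hx0 : x ≠ 0) (hxx : x ⬝ᵥ x = 0) (hyx : y ⬝ᵥ x = 0)
    (hy : y ⬝ᵥ y ≠ 0) : ∃ x' : V p, x' ⬝ᵥ x = 1 ∧ x' ⬝ᵥ y = 0 ∧ x' ⬝ᵥ x' = 0 := by
  have hxy : x ⬝ᵥ y = 0 := by rw [dotProduct_comm]; exact hyx
  obtain ⟨i, hi⟩ : ∃ i, x i ≠ 0 := Function.ne_iff.mp hx0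
  obtain ⟨v, hvx⟩ : ∃ v : V p, v ⬝ᵥ x ≠ 0 :=
    ⟨Pi.single i 1, by rw [dotProduct_comm, dotProduct_single, mul_one]; exact hi⟩
  -- `u ⊥ y` with `u·x = 1`
  obtain ⟨u, hux, huy⟩ : ∃ u : V p, u ⬝ᵥ x = 1 ∧ u ⬝ᵥ y = 0 := by
    refine ⟨(v ⬝ᵥ x)⁻¹ • (v - ((v ⬝ᵥ y) / (y ⬝ᵥ y)) • y), ?_, ?_⟩
    · rw [smul_dotProduct, smul_eq_mul, sub_dotProduct, smul_dotProduct, smul_eq_mul, hyx,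
        mul_zero, sub_zero, inv_mul_cancel₀ hvx]
    · rw [smul_dotProduct, smul_eq_mul, sub_dotProduct, smul_dotProduct, smul_eq_mul,
        div_mul_cancel₀ _ hy, sub_self, mul_zero]
  have hxu : x ⬝ᵥ u = 1 := by rw [dotProduct_comm]; exact hux
  obtain ⟨r, hr⟩ : ∃ r : ZMod p, u ⬝ᵥ u = 2 * r := ⟨u ⬝ᵥ u / 2, by
    have h2 : (2 : ZMod p) ≠ 0 := two_ne_zero_zmod hp2
    field_simp⟩
  refine ⟨u - r • x, ?_, ?_, ?_⟩
  · rw [sub_dotProduct, smul_dotProduct, smul_eq_mul, hxx, mul_zero, sub_zero, hux]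
  · rw [sub_dotProduct, smul_dotProduct, smul_eq_mul, hxy, mul_zero, sub_zero, huy]
  · simp only [sub_dotProduct, dotProduct_sub, smul_dotProduct, dotProduct_smul, smul_eq_mul, hxx,
      hux, hxu, mul_one, mul_zero, sub_zero]
    linear_combination hr

end Partner

section Basis

variable {x y x' : V p}

/-- The normal `x × y` of the plane `⟨x, y⟩` pairs non-trivially with `x'`:
`((x × y)·x')² = −Q(y)`. -/
theorem triple_sq_eq (hxx : x ⬝ᵥ x = 0) (hyx : y ⬝ᵥ x = 0) (hx'x : x' ⬝ᵥ x = 1)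
    (hx'y : x' ⬝ᵥ y = 0) (hx'x' : x' ⬝ᵥ x' = 0) : (w₁ x y ⬝ᵥ x') ^ 2 = -(y ⬝ᵥ y) := by
  have hxy : x ⬝ᵥ y = 0 := by rw [dotProduct_comm]; exact hyx
  have hxx' : x ⬝ᵥ x' = 1 := by rw [dotProduct_comm]; exact hx'x
  have hyx' : y ⬝ᵥ x' = 0 := by rw [dotProduct_comm]; exact hx'y
  rw [triple_sq, hxx, hxy, hxx', hyx', hx'x']
  ring

/-- **Coordinates**: `v = (v·x') x + (v·y / Q y) y + (v·x) x'` in the basis `x, y, x'`. -/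
theorem decomp (hxx : x ⬝ᵥ x = 0) (hyx : y ⬝ᵥ x = 0) (hy : y ⬝ᵥ y ≠ 0) (hx'x : x' ⬝ᵥ x = 1)
    (hx'y : x' ⬝ᵥ y = 0) (hx'x' : x' ⬝ᵥ x' = 0) (v : V p) :
    v = (v ⬝ᵥ x') • x + ((v ⬝ᵥ y) / (y ⬝ᵥ y)) • y + (v ⬝ᵥ x) • x' := by
  have hxy : x ⬝ᵥ y = 0 := by rw [dotProduct_comm]; exact hyx
  have hxx' : x ⬝ᵥ x' = 1 := by rw [dotProduct_comm]; exact hx'x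
  have hyx' : y ⬝ᵥ x' = 0 := by rw [dotProduct_comm]; exact hx'y
  have hn : w₁ x y ⬝ᵥ x' ≠ 0 := by
    intro h
    have h' := triple_sq_eq hxx hyx hx'x hx'y hx'x'
    rw [h, zero_pow two_ne_zero] at h'
    exact hy (neg_eq_zero.mp h'.symm)
  have hn0 : w₁ x y ≠ 0 := by rintro h; rw [h, zero_dotProduct] at hn; exact hn rfl
  obtain ⟨d, hddef⟩ : ∃ d : V p,
      d = v - ((v ⬝ᵥ x') • x + ((v ⬝ᵥ y) / (y ⬝ᵥ y)) • y + (v ⬝ᵥ x) • x') := ⟨_, rfl⟩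
  have hdx : x ⬝ᵥ d = 0 := by
    rw [hddef, dotProduct_sub, dotProduct_add, dotProduct_add, dotProduct_smul, dotProduct_smul,
      dotProduct_smul, smul_eq_mul, smul_eq_mul, smul_eq_mul, hxx, hxy, hxx', dotProduct_comm x v]
    ring
  have hdy : y ⬝ᵥ d = 0 := by
    rw [hddef, dotProduct_sub, dotProduct_add, dotProduct_add, dotProduct_smul, dotProduct_smul,
      dotProduct_smul, smul_eq_mul, smul_eq_mul, smul_eq_mul, hyx, hyx', div_mul_cancel₀ _ hy,
      dotProduct_comm y v]
    ring
  have hdx' : d ⬝ᵥ x' = 0 := by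
    rw [hddef, sub_dotProduct, add_dotProduct, add_dotProduct, smul_dotProduct, smul_dotProduct,
      smul_dotProduct, smul_eq_mul, smul_eq_mul, smul_eq_mul, hxx', hyx', hx'x']
    ring
  -- `d ⊥ x, y` ⇒ `d ∥ x × y`; then `d ⊥ x'` forces `d = 0`
  have hcross : w₁ x y ⨯₃ d = 0 := by
    rw [w₁, cross_cross_eq_smul_sub_smul, hdx, hdy, zero_smul, zero_smul, sub_zero]
  obtain ⟨a, ha⟩ := exists_smul_of_cross_eq_zero hn0 hcross
  have ha0 : a = 0 := by
    have h1 : a * (w₁ x y ⬝ᵥ x') = 0 := by rw [← smul_eq_mul, ← smul_dotProduct, ha, hdx']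
    exact (mul_eq_zero.mp h1).resolve_right hn
  have hd0 : d = 0 := by rw [← ha, ha0, zero_smul]
  rw [hddef] at hd0
  exact (sub_eq_zero.mp hd0)

/-- **A matrix is determined by its values on `x, y, x'`.** -/
theorem mat_eq (hxx : x ⬝ᵥ x = 0) (hyx : y ⬝ᵥ x = 0) (hy : y ⬝ᵥ y ≠ 0) (hx'x : x' ⬝ᵥ x = 1)
    (hx'y : x' ⬝ᵥ y = 0) (hx'x' : x' ⬝ᵥ x' = 0) {M N : Mat p 3} (hx : M *ᵥ x = N *ᵥ x)
    (h1 : M *ᵥ y = N *ᵥ y) (h2 : M *ᵥ x' = N *ᵥ x') : M = N := by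
  refine Matrix.ext_iff_mulVec.mpr fun v => ?_
  rw [decomp hxx hyx hy hx'x hx'y hx'x' v]
  simp only [Matrix.mulVec_add, Matrix.mulVec_smul, hx, h1, h2]

end Basis

/-! ## The stabiliser of an isotropic vector -/

section Stab

variable {x y : V p} {g : Mat p 3}

/-- Values of `E_β` on `x, y, x'`. -/
theorem siegel_values (hxx : x ⬝ᵥ x = 0) (hyx : y ⬝ᵥ x = 0) {x' : V p} (hx'x : x' ⬝ᵥ x = 1)
    (hx'y : x' ⬝ᵥ y = 0) (β : ZMod p) :
    siegel x (β • y) x = x ∧ siegel x (β • y) y = y - (β * (y ⬝ᵥ y)) • x ∧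
      siegel x (β • y) x' = x' + β • y - (β ^ 2 * (y ⬝ᵥ y) / 2) • x := by
  have hxy : x ⬝ᵥ y = 0 := by rw [dotProduct_comm]; exact hyx
  refine ⟨?_, ?_, ?_⟩
  · simp [siegel, hxx, dotProduct_smul, hxy]
  · simp only [siegel, hyx, dotProduct_smul, smul_eq_mul, zero_smul, add_zero, mul_zero, sub_zero]
  · simp only [siegel, hx'x, hx'y, dotProduct_smul, smul_dotProduct, smul_eq_mul, mul_zero,
      zero_smul, sub_zero, mul_one, smul_smul]
    match_scalars <;> ring

/-- **Structure theorem.**  `gᵀ g = 1`, `g x = x` (`x ≠ 0` isotropic, `y ⊥ x` anisotropic,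
`p ≠ 2`) ⇒ `g = E_β` or `g = E_β R_y` for some `β`. -/
theorem stab_structure (hp2 : p ≠ 2) (hx0 : x ≠ 0) (hxx : x ⬝ᵥ x = 0) (hyx : y ⬝ᵥ x = 0)
    (hy : y ⬝ᵥ y ≠ 0) (hg : gᵀ * g = 1) (hgx : g *ᵥ x = x) :
    ∃ β : ZMod p, g = siegelMat x (β • y) ∨ g = siegelMat x (β • y) * reflMat y := by
  have h2 : (2 : ZMod p) ≠ 0 := two_ne_zero_zmod hp2
  have hxy : x ⬝ᵥ y = 0 := by rw [dotProduct_comm]; exact hyx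
  obtain ⟨x', hx'x, hx'y, hx'x'⟩ := exists_partner hp2 hx0 hxx hyx hy
  have hxx' : x ⬝ᵥ x' = 1 := by rw [dotProduct_comm]; exact hx'x
  have hyx' : y ⬝ᵥ x' = 0 := by rw [dotProduct_comm]; exact hx'y
  have iso : ∀ v w : V p, (g *ᵥ v) ⬝ᵥ (g *ᵥ w) = v ⬝ᵥ w := fun v w => by
    rw [Matrix.dotProduct_mulVec, ← Matrix.vecMul_transpose, Matrix.vecMul_vecMul, hg,
      Matrix.vecMul_one]
  obtain ⟨a, hadef⟩ : ∃ a, a = g *ᵥ y := ⟨_, rfl⟩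
  obtain ⟨b, hbdef⟩ : ∃ b, b = g *ᵥ x' := ⟨_, rfl⟩
  have hax : a ⬝ᵥ x = 0 := by rw [hadef, ← hgx, iso, hyx]
  have haa : a ⬝ᵥ a = y ⬝ᵥ y := by rw [hadef, iso]
  have hbx : b ⬝ᵥ x = 1 := by rw [hbdef, ← hgx, iso, hx'x]
  have hbb : b ⬝ᵥ b = 0 := by rw [hbdef, iso, hx'x']
  have hba : b ⬝ᵥ a = 0 := by rw [hadef, hbdef, iso, hx'y]
  -- coordinates of `a` and `b`
  obtain ⟨A, hAdef⟩ : ∃ A, A = (a ⬝ᵥ y) / (y ⬝ᵥ y) := ⟨_, rfl⟩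
  obtain ⟨β, hβdef⟩ : ∃ β, β = (b ⬝ᵥ y) / (y ⬝ᵥ y) := ⟨_, rfl⟩
  have hay : a ⬝ᵥ y = A * (y ⬝ᵥ y) := by rw [hAdef, div_mul_cancel₀ _ hy]
  have hby : b ⬝ᵥ y = β * (y ⬝ᵥ y) := by rw [hβdef, div_mul_cancel₀ _ hy]
  have ha : a = (a ⬝ᵥ x') • x + A • y := by
    have h := decomp hxx hyx hy hx'x hx'y hx'x' a
    rwa [hax, zero_smul, add_zero, ← hAdef] at h
  have hb : b = (b ⬝ᵥ x') • x + β • y + x' := by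
    have h := decomp hxx hyx hy hx'x hx'y hx'x' b
    rwa [hbx, one_smul, ← hβdef] at h
  -- `A² = 1` from `Q(a) = Q(y)`
  have hA : A = 1 ∨ A = -1 := by
    have h1 : ((a ⬝ᵥ x') • x + A • y) ⬝ᵥ a = A * (a ⬝ᵥ y) := by
      rw [add_dotProduct, smul_dotProduct, smul_dotProduct, smul_eq_mul, smul_eq_mul,
        dotProduct_comm x a, hax, mul_zero, zero_add, dotProduct_comm y a]
    rw [← ha, haa, hay] at h1
    have h3 : (A ^ 2 - 1) * (y ⬝ᵥ y) = 0 := by linear_combination -h1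
    have h4 : A ^ 2 - 1 = 0 := (mul_eq_zero.mp h3).resolve_right hy
    exact eq_or_eq_neg_of_sq_eq_sq A 1 (by linear_combination h4)
  -- `a·x' = −A (b·y)` from `b ⊥ a`, and `b·x' = −β² Q(y)/2` from `Q(b) = 0`
  have hax' : a ⬝ᵥ x' = -(A * (β * (y ⬝ᵥ y))) := by
    have h1 : b ⬝ᵥ a = a ⬝ᵥ x' + A * (b ⬝ᵥ y) := by
      conv_lhs => rw [ha]
      rw [dotProduct_add, dotProduct_smul, dotProduct_smul, smul_eq_mul, smul_eq_mul, hbx, mul_one]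
    rw [hba, hby] at h1
    linear_combination -h1
  have hbx' : b ⬝ᵥ x' = -(β ^ 2 * (y ⬝ᵥ y) / 2) := by
    have h1 : b ⬝ᵥ ((b ⬝ᵥ x') • x + β • y + x') = b ⬝ᵥ x' + β * (b ⬝ᵥ y) + b ⬝ᵥ x' := by
      rw [dotProduct_add, dotProduct_add, dotProduct_smul, dotProduct_smul, smul_eq_mul,
        smul_eq_mul, hbx, mul_one]
    rw [← hb, hbb, hby] at h1
    field_simp
    linear_combination -h1
  obtain ⟨hEx, hEy, hEx'⟩ := siegel_values hxx hyx hx'x hx'y β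
  refine ⟨β, ?_⟩
  rcases hA with hA1 | hA1
  · -- proper case: `g = E_β`
    left
    refine mat_eq hxx hyx hy hx'x hx'y hx'x' ?_ ?_ ?_
    · rw [hgx, siegelMat_mulVec, hEx]
    · rw [← hadef, siegelMat_mulVec, hEy, ha, hax', hA1]
      module
    · rw [← hbdef, siegelMat_mulVec, hEx', hb, hbx']
      module
  · -- improper case: `g = E_β R_y`
    right
    have hRx : reflMat y *ᵥ x = x := reflMat_mulVec y x (by rw [dotProduct_comm]; exact hxy)
    have hRy : reflMat y *ᵥ y = -y := by
      rw [refl_apply, div_mul_cancel₀ _ hy, two_smul]; abel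
    have hRx' : reflMat y *ᵥ x' = x' := reflMat_mulVec y x' hyx'
    refine mat_eq hxx hyx hy hx'x hx'y hx'x' ?_ ?_ ?_
    · rw [hgx, ← Matrix.mulVec_mulVec, hRx, siegelMat_mulVec, hEx]
    · rw [← hadef, ← Matrix.mulVec_mulVec, hRy, Matrix.mulVec_neg, siegelMat_mulVec, hEy, ha,
        hax', hA1]
      module
    · rw [← hbdef, ← Matrix.mulVec_mulVec, hRx', siegelMat_mulVec, hEx', hb, hbx']
      module

/-- `det E_β = 1` (matrix form). -/
theorem det_siegelMat (hp2 : p ≠ 2) (hxx : x ⬝ᵥ x = 0) (hyx : y ⬝ᵥ x = 0) (hy : y ⬝ᵥ y ≠ 0)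
    (β : ZMod p) : (siegelMat x (β • y)).det = 1 := by
  rw [← coe_siegelGL hp2 hxx hyx hy]; exact det_siegelGL hxx hyx hy β

/-- **Proper stabiliser of an isotropic vector** = the Siegel transformations. -/
theorem stab_proper (hp2 : p ≠ 2) (hx0 : x ≠ 0) (hxx : x ⬝ᵥ x = 0) (hyx : y ⬝ᵥ x = 0)
    (hy : y ⬝ᵥ y ≠ 0) (hg : gᵀ * g = 1) (hgx : g *ᵥ x = x) (hdet : g.det = 1) :
    ∃ β : ZMod p, g = siegelMat x (β • y) := by
  obtain ⟨β, h | h⟩ := stab_structure hp2 hx0 hxx hyx hy hg hgx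
  · exact ⟨β, h⟩
  · exfalso
    rw [h, Matrix.det_mul, det_siegelMat hp2 hxx hyx hy, det_reflMat y hy, one_mul] at hdet
    exact two_ne_zero_zmod hp2 (by linear_combination -hdet)

/-- **Improper isometries fixing an isotropic vector** are `E_β R_y`. -/
theorem stab_improper (hp2 : p ≠ 2) (hx0 : x ≠ 0) (hxx : x ⬝ᵥ x = 0) (hyx : y ⬝ᵥ x = 0)
    (hy : y ⬝ᵥ y ≠ 0) (hg : gᵀ * g = 1) (hgx : g *ᵥ x = x) (hdet : g.det = -1) :
    ∃ β : ZMod p, g = siegelMat x (β • y) * reflMat y := by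
  obtain ⟨β, h | h⟩ := stab_structure hp2 hx0 hxx hyx hy hg hgx
  · exfalso
    rw [h, det_siegelMat hp2 hxx hyx hy] at hdet
    exact two_ne_zero_zmod hp2 (by linear_combination hdet)
  · exact ⟨β, h⟩

/-- In `GL₃(𝔽_p)`: a proper isometry fixing `x` is `siegelGL x y β`. -/
theorem stab_proper_GL (hp2 : p ≠ 2) (hx0 : x ≠ 0) (hxx : x ⬝ᵥ x = 0) (hyx : y ⬝ᵥ x = 0)
    (hy : y ⬝ᵥ y ≠ 0) {s : GLm p 3} (hg : (s : Mat p 3)ᵀ * s = 1) (hgx : (s : Mat p 3) *ᵥ x = x)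
    (hdet : (s : Mat p 3).det = 1) : ∃ β : ZMod p, s = siegelGL x y β := by
  obtain ⟨β, h⟩ := stab_proper hp2 hx0 hxx hyx hy hg hgx hdet
  exact ⟨β, Units.ext (by rw [h, coe_siegelGL hp2 hxx hyx hy])⟩

end Stab

end ReflectionClassStabIso
end Summit.MatrixMultiplication.MatrixMultiplication.Theorems.SubgroupIdentityDesigns.Negative
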